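import Summits.CriticalPhenomena.SAWScalingLimit.Theorems.SAWDefectDecoherenceBoundaryClosureRIdentificationUniformiser
import Literature.Analysis.Complex.SchwarzReflection
import Literature.Analysis.Complex.InjectiveHolomorphic
import HarnessLib

/-!
# `BoundaryClosureR` (stmt-CriticalPhenomena-14004), line `polygon-parity-squeeze`, stub
# `transportRigidity` (E), part F2: Schwarz reflection at a flat boundary piece of ANY direction

Tools for the identification step (E) of mechanism (A).  Let `Ω` be open and FLAT of direction
`n` (`‖n‖ = 1`) in the disc `B(z₀, s)`: `Ω ∩ B = {w | 0 < re((w - z₀) conj n)} ∩ B`.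

* elementary membership / closure / frontier facts in a flat disc (`mem_iff_of_flatDir`,
  `mem_closure_of_flatDir`, `re_nonneg_of_mem_closure`, `mem_frontier_iff_of_flatDir`);
* `exists_flatReflection` — for `F` holomorphic with `im F > 0` on `Ω ∩ B` and a continuous
  INJECTIVE extension `Fb` to `closure Ω ∩ B`, real on `frontier Ω ∩ B`, the Schwarz reflection
  `G` across the chord: holomorphic and injective on the whole disc, `= Fb` on `closure Ω ∩ B`,
  `im G > 0` exactly on `Ω ∩ B`, `im G = 0` exactly on the chord, `G' ≠ 0` (rotate the chord to
  the real axis by `w ↦ i conj(n) (w - z₀)`, reflect with `Complex.schwarzReflection`, rotate back);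
* `exists_localLog` — a holomorphic logarithm of `G'` on a smaller concentric disc
  (`log (G'/G'(z₀)) + const`), and `localLog_eqOn` — it can be normalised to agree with any given
  continuous logarithm of `G'` on the (convex) piece `Ω ∩ B` (rigidity of continuous logarithms,
  `Identification.sub_eq_sub_of_exp_eq_mul_exp`).

References: Conway, *Functions of One Complex Variable I* (1978), IX.1.1; Pommerenke, *Boundary
Behaviour of Conformal Maps* (1992), Thm. 2.6.
-/

noncomputable section

open scoped Topology ComplexConjugate
open Filter Set Metric Complex
open Summit.CriticalPhenomena.SAWScalingLimit.Theorems.PickHalfPlane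

namespace Summit.CriticalPhenomena.SAWScalingLimit.Theorems.PolygonParitySqueeze

namespace Transport

/-! ### 1. Flat discs of direction `n` -/

/-- In a flat disc, membership in `Ω` is decided by the sign of `re((w - z₀) conj n)`.
[folklore] -/
theorem mem_iff_of_flatDir {Ω : Set ℂ} {z₀ n : ℂ} {s : ℝ}
    (hflat : Ω ∩ ball z₀ s = {w : ℂ | 0 < ((w - z₀) * conj n).re} ∩ ball z₀ s) {w : ℂ}
    (hw : w ∈ ball z₀ s) : w ∈ Ω ↔ 0 < ((w - z₀) * conj n).re := by
  have h := Set.ext_iff.1 hflat w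
  simp only [mem_inter_iff, mem_setOf_eq] at h
  exact ⟨fun h' => (h.1 ⟨h', hw⟩).1, fun h' => (h.2 ⟨h', hw⟩).1⟩

/-- In a flat disc of direction `n ≠ 0`, the points of the closed half-disc
`re((w - z₀) conj n) ≥ 0` lie in `closure Ω` (approach along `w + t n`, `t → 0⁺`). [folklore] -/
theorem mem_closure_of_flatDir {Ω : Set ℂ} {z₀ n : ℂ} {s : ℝ} (hn : n ≠ 0)
    (hflat : Ω ∩ ball z₀ s = {w : ℂ | 0 < ((w - z₀) * conj n).re} ∩ ball z₀ s) {w : ℂ}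
    (hw : w ∈ ball z₀ s) (h : 0 ≤ ((w - z₀) * conj n).re) : w ∈ closure Ω := by
  have hray : Tendsto (fun t : ℝ => w + (t : ℂ) * n) (𝓝[>] 0) (𝓝 w) := by
    have : Continuous fun t : ℝ => w + (t : ℂ) * n := by fun_prop
    simpa using (this.tendsto 0).mono_left nhdsWithin_le_nhds
  refine mem_closure_of_tendsto hray ?_
  have hball : ∀ᶠ t : ℝ in 𝓝[>] 0, w + (t : ℂ) * n ∈ ball z₀ s :=
    hray (isOpen_ball.mem_nhds hw)
  filter_upwards [hball, self_mem_nhdsWithin] with t ht ht0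
  refine (mem_iff_of_flatDir hflat ht).2 ?_
  have hnn : n * conj n = ((‖n‖ ^ 2 : ℝ) : ℂ) := by
    rw [mul_conj, ← Complex.normSq_eq_norm_sq]
  have : ((w + (t : ℂ) * n - z₀) * conj n).re = ((w - z₀) * conj n).re + t * ‖n‖ ^ 2 := by
    have : (w + (t : ℂ) * n - z₀) * conj n = (w - z₀) * conj n + (t : ℂ) * (n * conj n) := by ring
    rw [this, hnn, add_re, ← ofReal_mul, ofReal_re]
  rw [this]
  have ht0' : (0 : ℝ) < t := ht0
  have := mul_pos ht0' (pow_pos (norm_pos_iff.2 hn) 2)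
  linarith

/-- In a flat disc, points of `closure Ω` satisfy `re((w - z₀) conj n) ≥ 0`. [folklore] -/
theorem re_nonneg_of_mem_closure {Ω : Set ℂ} {z₀ n : ℂ} {s : ℝ}
    (hflat : Ω ∩ ball z₀ s = {w : ℂ | 0 < ((w - z₀) * conj n).re} ∩ ball z₀ s) {w : ℂ}
    (hw : w ∈ ball z₀ s) (h : w ∈ closure Ω) : 0 ≤ ((w - z₀) * conj n).re := by
  have h1 : w ∈ closure (Ω ∩ ball z₀ s) := by
    rw [inter_comm]; exact isOpen_ball.inter_closure ⟨hw, h⟩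
  rw [hflat] at h1
  have hC : IsClosed {w : ℂ | 0 ≤ ((w - z₀) * conj n).re} :=
    isClosed_le continuous_const (continuous_re.comp (by fun_prop))
  have hsub : {w : ℂ | 0 < ((w - z₀) * conj n).re} ∩ ball z₀ s ⊆
      {w : ℂ | 0 ≤ ((w - z₀) * conj n).re} := fun x hx =>
    show 0 ≤ ((x - z₀) * conj n).re from le_of_lt hx.1
  exact closure_minimal hsub hC h1

/-- In a flat disc of direction `n ≠ 0` for an OPEN `Ω`, the frontier points are exactly the
points of the chord `re((w - z₀) conj n) = 0`. [folklore] -/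
theorem mem_frontier_iff_of_flatDir {Ω : Set ℂ} (hΩ : IsOpen Ω) {z₀ n : ℂ} {s : ℝ} (hn : n ≠ 0)
    (hflat : Ω ∩ ball z₀ s = {w : ℂ | 0 < ((w - z₀) * conj n).re} ∩ ball z₀ s) {w : ℂ}
    (hw : w ∈ ball z₀ s) : w ∈ frontier Ω ↔ ((w - z₀) * conj n).re = 0 := by
  rw [frontier, hΩ.interior_eq]
  constructor
  · rintro ⟨hcl, hnot⟩
    have h1 := re_nonneg_of_mem_closure hflat hw hcl
    have h2 : ¬ 0 < ((w - z₀) * conj n).re := fun h => hnot ((mem_iff_of_flatDir hflat hw).2 h)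
    push Not at h2
    exact le_antisymm h2 h1
  · intro h0
    refine ⟨mem_closure_of_flatDir hn hflat hw h0.symm.le, fun hwΩ => ?_⟩
    have := (mem_iff_of_flatDir hflat hw).1 hwΩ
    rw [h0] at this
    exact lt_irrefl _ this

/-- Flatness is inherited by sub-discs centred on the chord. [folklore] -/
theorem flatDir_subball {Ω : Set ℂ} {z₀ n : ℂ} {s : ℝ}
    (hflat : Ω ∩ ball z₀ s = {w : ℂ | 0 < ((w - z₀) * conj n).re} ∩ ball z₀ s) {z : ℂ} {s' : ℝ}
    (hz : ((z - z₀) * conj n).re = 0) (hsub : ball z s' ⊆ ball z₀ s) :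
    Ω ∩ ball z s' = {w : ℂ | 0 < ((w - z) * conj n).re} ∩ ball z s' := by
  ext w
  simp only [mem_inter_iff, mem_setOf_eq]
  constructor
  · rintro ⟨hwΩ, hw⟩
    refine ⟨?_, hw⟩
    have h := (mem_iff_of_flatDir hflat (hsub hw)).1 hwΩ
    have : (w - z) * conj n = (w - z₀) * conj n - (z - z₀) * conj n := by ring
    rw [this, sub_re, hz, sub_zero]; exact h
  · rintro ⟨hℓ, hw⟩
    refine ⟨(mem_iff_of_flatDir hflat (hsub hw)).2 ?_, hw⟩
    have : (w - z₀) * conj n = (w - z) * conj n + (z - z₀) * conj n := by ring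
    rw [this, add_re, hz, add_zero]; exact hℓ

/-- A flat piece `{re((w - z₀) conj n) > 0} ∩ B(z₀, s)` is convex. [folklore] -/
theorem convex_flatPiece (z₀ n : ℂ) (s : ℝ) :
    Convex ℝ ({w : ℂ | 0 < ((w - z₀) * conj n).re} ∩ ball z₀ s) := by
  have hlin : IsLinearMap ℝ fun w : ℂ => (w * conj n).re :=
    { map_add := fun x y => by simp [add_mul]
      map_smul := fun a x => by simp [Complex.real_smul, mul_assoc] }
  have h1 : {w : ℂ | 0 < ((w - z₀) * conj n).re} = {w : ℂ | (z₀ * conj n).re < (w * conj n).re} := by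
    ext w; simp only [mem_setOf_eq, sub_mul, sub_re, sub_pos]
  rw [h1]
  exact (convex_halfSpace_gt hlin _).inter (convex_ball z₀ s)

/-- A flat piece is preconnected. [folklore] -/
theorem isPreconnected_flatPiece (z₀ n : ℂ) (s : ℝ) :
    IsPreconnected ({w : ℂ | 0 < ((w - z₀) * conj n).re} ∩ ball z₀ s) :=
  (convex_flatPiece z₀ n s).isPreconnected

/-! ### 2. Schwarz reflection across a flat chord of any direction -/

/-- **Schwarz reflection at a flat boundary piece of direction `n`.**  Let `Ω` be open with
`Ω ∩ B(z₀,s) = {re((w - z₀) conj n) > 0} ∩ B(z₀,s)` (`‖n‖ = 1`), `F` holomorphic with `im F > 0`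
on `Ω ∩ B`, and `Fb` a continuous injective extension of `F` to `closure Ω ∩ B`, real on
`frontier Ω ∩ B`.  Then the reflection `G` of `Fb` across the chord is holomorphic and injective on
`B(z₀,s)`, agrees with `Fb` on `closure Ω ∩ B`, has `im G > 0` only on `Ω`, `im G = 0` only on the
chord, and `G' ≠ 0` on the disc.  (Rotate by `w ↦ i conj(n) (w - z₀)`, apply
`Complex.differentiableOn_schwarzReflection`, rotate back; injectivity from the sign of the
imaginary part off the chord; `G' ≠ 0` from injectivity.) [cite: PommerenkeBBCM1992, Thm. 2.6] -/
theorem exists_flatReflection {Ω : Set ℂ} (hΩ : IsOpen Ω) {z₀ n : ℂ} (hn : ‖n‖ = 1) {s : ℝ}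
    (hflat : Ω ∩ ball z₀ s = {w : ℂ | 0 < ((w - z₀) * conj n).re} ∩ ball z₀ s)
    {F Fb : ℂ → ℂ} (hF : DifferentiableOn ℂ F (Ω ∩ ball z₀ s))
    (hpos : ∀ w ∈ Ω ∩ ball z₀ s, 0 < (F w).im)
    (hFbc : ContinuousOn Fb (closure Ω ∩ ball z₀ s)) (hFb : EqOn Fb F (Ω ∩ ball z₀ s))
    (hreal : ∀ w ∈ frontier Ω ∩ ball z₀ s, (Fb w).im = 0)
    (hinj : InjOn Fb (closure Ω ∩ ball z₀ s)) :
    ∃ G : ℂ → ℂ, DifferentiableOn ℂ G (ball z₀ s) ∧ InjOn G (ball z₀ s) ∧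
      EqOn G Fb (closure Ω ∩ ball z₀ s) ∧
      (∀ w ∈ ball z₀ s, 0 < (G w).im → w ∈ Ω) ∧
      (∀ w ∈ ball z₀ s, (G w).im = 0 → w ∈ frontier Ω) ∧
      (∀ w ∈ ball z₀ s, deriv G w ≠ 0) := by
  have hn0 : n ≠ 0 := fun h => by simp [h] at hn
  have hnn : n * conj n = 1 := by rw [mul_conj, Complex.normSq_eq_norm_sq, hn]; simp
  -- the rotations `T` (axis → chord) and `S` (chord → axis)
  set T : ℂ → ℂ := fun ζ => z₀ - I * n * ζ with hT
  set S : ℂ → ℂ := fun w => I * conj n * (w - z₀) with hS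
  have hTS : ∀ w, T (S w) = w := fun w => by
    simp only [hT, hS]
    have : I * n * (I * conj n * (w - z₀)) = (I * I) * (n * conj n) * (w - z₀) := by ring
    rw [this, hnn, I_mul_I]; ring
  have hST : ∀ ζ, S (T ζ) = ζ := fun ζ => by
    simp only [hT, hS]
    have : I * conj n * (z₀ - I * n * ζ - z₀) = -(I * I) * (n * conj n) * ζ := by ring
    rw [this, hnn, I_mul_I]; ring
  have hnormT : ∀ ζ, ‖T ζ - z₀‖ = ‖ζ‖ := fun ζ => by
    simp only [hT]; rw [show z₀ - I * n * ζ - z₀ = -(I * n * ζ) by ring, norm_neg, norm_mul,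
      norm_mul, norm_I, hn]; ring
  have hnormS : ∀ w, ‖S w‖ = ‖w - z₀‖ := fun w => by
    simp only [hS]; rw [norm_mul, norm_mul, norm_I, norm_conj, hn]; ring
  have hℓT : ∀ ζ, ((T ζ - z₀) * conj n).re = ζ.im := fun ζ => by
    have : (T ζ - z₀) * conj n = -I * ζ * (n * conj n) := by simp only [hT]; ring
    rw [this, hnn, mul_one]; simp
  have hℓS : ∀ w, (S w).im = ((w - z₀) * conj n).re := fun w => by
    have := hℓT (S w); rw [hTS] at this; exact this.symm
  have hballT : ∀ ζ, ζ ∈ ball (0 : ℂ) s ↔ T ζ ∈ ball z₀ s := fun ζ => by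
    rw [mem_ball_zero_iff, mem_ball, dist_eq_norm, hnormT]
  have hballS : ∀ w, w ∈ ball z₀ s → S w ∈ ball (0 : ℂ) s := fun w hw => by
    rwa [mem_ball_zero_iff, hnormS, ← dist_eq_norm, ← mem_ball]
  have hT_cont : Continuous T := by simp only [hT]; fun_prop
  have hS_diff : Differentiable ℂ S := by simp only [hS]; fun_prop
  -- membership along `T`
  have hmemΩ : ∀ ζ ∈ ball (0 : ℂ) s, 0 < ζ.im → T ζ ∈ Ω ∩ ball z₀ s := fun ζ hζ hζim =>
    ⟨(mem_iff_of_flatDir hflat ((hballT ζ).1 hζ)).2 (by rwa [hℓT]), (hballT ζ).1 hζ⟩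
  have hmemcl : ∀ ζ ∈ ball (0 : ℂ) s, 0 ≤ ζ.im → T ζ ∈ closure Ω ∩ ball z₀ s := fun ζ hζ hζim =>
    ⟨mem_closure_of_flatDir hn0 hflat ((hballT ζ).1 hζ) (by rwa [hℓT]), (hballT ζ).1 hζ⟩
  have hmemfr : ∀ ζ ∈ ball (0 : ℂ) s, ζ.im = 0 → T ζ ∈ frontier Ω ∩ ball z₀ s := fun ζ hζ hζim =>
    ⟨(mem_frontier_iff_of_flatDir hΩ hn0 hflat ((hballT ζ).1 hζ)).2 (by rw [hℓT, hζim]),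
      (hballT ζ).1 hζ⟩
  -- the pulled-back boundary function and its reflection
  set f₀ : ℂ → ℂ := fun ζ => Fb (T ζ) with hf₀
  have hsymm : ∀ ζ ∈ ball (0 : ℂ) s, conj ζ ∈ ball (0 : ℂ) s := fun ζ hζ => by
    rwa [mem_ball_zero_iff, norm_conj, ← mem_ball_zero_iff]
  have hc : ContinuousOn f₀ (ball (0 : ℂ) s ∩ {ζ | 0 ≤ ζ.im}) :=
    hFbc.comp hT_cont.continuousOn fun ζ hζ => hmemcl ζ hζ.1 hζ.2
  have hopen : IsOpen (Ω ∩ ball z₀ s) := hΩ.inter isOpen_ball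
  have hd : DifferentiableOn ℂ f₀ (ball (0 : ℂ) s ∩ {ζ | 0 < ζ.im}) := by
    rintro ζ ⟨hζ, hζim⟩
    have hm := hmemΩ ζ hζ hζim
    have h1 : DifferentiableAt ℂ Fb (T ζ) :=
      (hF.differentiableAt (hopen.mem_nhds hm)).congr_of_eventuallyEq
        (Filter.eventuallyEq_of_mem (hopen.mem_nhds hm) hFb)
    exact (h1.comp ζ (by simp only [hT]; fun_prop)).differentiableWithinAt
  have hrealζ : ∀ ζ ∈ ball (0 : ℂ) s, ζ.im = 0 → conj (f₀ ζ) = f₀ ζ := fun ζ hζ hζim =>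
    conj_eq_iff_im.2 (hreal _ (hmemfr ζ hζ hζim))
  set R : ℂ → ℂ := schwarzReflection f₀ with hRdef
  have hR : DifferentiableOn ℂ R (ball (0 : ℂ) s) :=
    differentiableOn_schwarzReflection isOpen_ball hsymm hc hd hrealζ
  -- the reflected map `G = R ∘ S`
  set G : ℂ → ℂ := fun w => R (S w) with hGdef
  have hGd : DifferentiableOn ℂ G (ball z₀ s) :=
    hR.comp hS_diff.differentiableOn fun w hw => hballS w hw
  -- values of `G`
  have hGup : ∀ w ∈ ball z₀ s, 0 ≤ ((w - z₀) * conj n).re → G w = Fb w := fun w hw hℓ => by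
    show R (S w) = Fb w
    rw [hRdef, schwarzReflection_of_nonneg (by rwa [hℓS])]
    show Fb (T (S w)) = Fb w
    rw [hTS]
  have hreflmem : ∀ w ∈ ball z₀ s, ((w - z₀) * conj n).re < 0 →
      T (conj (S w)) ∈ Ω ∩ ball z₀ s := fun w hw hℓ =>
    hmemΩ _ (hsymm _ (hballS w hw)) (by rw [conj_im, hℓS]; linarith)
  have hGlow : ∀ w ∈ ball z₀ s, ((w - z₀) * conj n).re < 0 →
      G w = conj (Fb (T (conj (S w)))) := fun w hw hℓ => by
    show R (S w) = _
    rw [hRdef, schwarzReflection_of_neg (by rwa [hℓS])]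
  have hGim_pos : ∀ w ∈ ball z₀ s, 0 < ((w - z₀) * conj n).re → 0 < (G w).im := fun w hw hℓ => by
    rw [hGup w hw hℓ.le, hFb ⟨(mem_iff_of_flatDir hflat hw).2 hℓ, hw⟩]
    exact hpos w ⟨(mem_iff_of_flatDir hflat hw).2 hℓ, hw⟩
  have hGim_zero : ∀ w ∈ ball z₀ s, ((w - z₀) * conj n).re = 0 → (G w).im = 0 := fun w hw hℓ => by
    rw [hGup w hw hℓ.symm.le]
    exact hreal w ⟨(mem_frontier_iff_of_flatDir hΩ hn0 hflat hw).2 hℓ, hw⟩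
  have hGim_neg : ∀ w ∈ ball z₀ s, ((w - z₀) * conj n).re < 0 → (G w).im < 0 := fun w hw hℓ => by
    rw [hGlow w hw hℓ, conj_im, neg_lt_zero, hFb (hreflmem w hw hℓ)]
    exact hpos _ (hreflmem w hw hℓ)
  -- the three sign statements
  have hG_pos_iff : ∀ w ∈ ball z₀ s, 0 < (G w).im → w ∈ Ω := by
    intro w hw him
    rcases lt_trichotomy (((w - z₀) * conj n).re) 0 with hlt | heq | hgt
    · exact absurd him (not_lt.2 (hGim_neg w hw hlt).le)
    · exact absurd (hGim_zero w hw heq) him.ne'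
    · exact (mem_iff_of_flatDir hflat hw).2 hgt
  have hG_zero_iff : ∀ w ∈ ball z₀ s, (G w).im = 0 → w ∈ frontier Ω := by
    intro w hw him
    rcases lt_trichotomy (((w - z₀) * conj n).re) 0 with hlt | heq | hgt
    · exact absurd him (hGim_neg w hw hlt).ne
    · exact (mem_frontier_iff_of_flatDir hΩ hn0 hflat hw).2 heq
    · exact absurd him (hGim_pos w hw hgt).ne'
  -- injectivity
  have hclmem : ∀ w ∈ ball z₀ s, 0 ≤ ((w - z₀) * conj n).re → w ∈ closure Ω ∩ ball z₀ s :=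
    fun w hw hℓ => ⟨mem_closure_of_flatDir hn0 hflat hw hℓ, hw⟩
  have hGinj : InjOn G (ball z₀ s) := by
    intro w₁ hw₁ w₂ hw₂ heq
    by_cases h₁ : 0 ≤ ((w₁ - z₀) * conj n).re <;> by_cases h₂ : 0 ≤ ((w₂ - z₀) * conj n).re
    · rw [hGup w₁ hw₁ h₁, hGup w₂ hw₂ h₂] at heq
      exact hinj (hclmem w₁ hw₁ h₁) (hclmem w₂ hw₂ h₂) heq
    · exfalso
      have ha : 0 ≤ (G w₁).im := by
        rcases h₁.lt_or_eq with hlt | heq'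
        · exact (hGim_pos w₁ hw₁ hlt).le
        · exact (hGim_zero w₁ hw₁ heq'.symm).symm.le
      rw [heq] at ha
      exact absurd (hGim_neg w₂ hw₂ (not_le.1 h₂)) (not_lt.2 ha)
    · exfalso
      have ha : 0 ≤ (G w₂).im := by
        rcases h₂.lt_or_eq with hlt | heq'
        · exact (hGim_pos w₂ hw₂ hlt).le
        · exact (hGim_zero w₂ hw₂ heq'.symm).symm.le
      rw [← heq] at ha
      exact absurd (hGim_neg w₁ hw₁ (not_le.1 h₁)) (not_lt.2 ha)
    · rw [hGlow w₁ hw₁ (not_le.1 h₁), hGlow w₂ hw₂ (not_le.1 h₂)] at heq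
      have h3 := hinj ⟨subset_closure (hreflmem w₁ hw₁ (not_le.1 h₁)).1,
          (hreflmem w₁ hw₁ (not_le.1 h₁)).2⟩
        ⟨subset_closure (hreflmem w₂ hw₂ (not_le.1 h₂)).1, (hreflmem w₂ hw₂ (not_le.1 h₂)).2⟩
        ((starRingEnd ℂ).injective heq)
      have h4 : S (T (conj (S w₁))) = S (T (conj (S w₂))) := by rw [h3]
      rw [hST, hST] at h4
      have h5 : S w₁ = S w₂ := (starRingEnd ℂ).injective h4
      have h6 : T (S w₁) = T (S w₂) := by rw [h5]
      rwa [hTS, hTS] at h6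
  refine ⟨G, hGd, hGinj, fun w hw => hGup w hw.2 (re_nonneg_of_mem_closure hflat hw.2 hw.1),
    hG_pos_iff, hG_zero_iff, fun w hw => ?_⟩
  exact Literature.Analysis.Complex.SCV.deriv_ne_zero_of_injOn hGd isOpen_ball hGinj hw

/-! ### 3. Local holomorphic logarithms -/

/-- **A local holomorphic logarithm of a zero-free derivative.**  If `G` is holomorphic on
`B(z₀, s)` with `G'(z₀) ≠ 0`, then on some concentric disc `B(z₀, s₁)`, `s₁ ≤ s`, there is a
holomorphic `M` with `exp ∘ M = G'` (namely `log (G'/G'(z₀)) + log G'(z₀)`, the quotient staying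
in the disc `B(1, 1) ⊆ ℂ ∖ (-∞, 0]` by continuity of `G'`). [folklore] -/
theorem exists_localLog {G : ℂ → ℂ} {z₀ : ℂ} {s : ℝ} (hs : 0 < s)
    (hG : DifferentiableOn ℂ G (ball z₀ s)) (hG0 : deriv G z₀ ≠ 0) :
    ∃ (s₁ : ℝ) (M : ℂ → ℂ), 0 < s₁ ∧ s₁ ≤ s ∧ DifferentiableOn ℂ M (ball z₀ s₁) ∧
      ∀ w ∈ ball z₀ s₁, Complex.exp (M w) = deriv G w := by
  set G' : ℂ → ℂ := deriv G with hG'def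
  have hb : ball z₀ s ∈ 𝓝 z₀ := isOpen_ball.mem_nhds (mem_ball_self hs)
  have hG'd : DifferentiableOn ℂ G' (ball z₀ s) :=
    ((hG.analyticOnNhd isOpen_ball).deriv).differentiableOn
  have hG'c : ContinuousOn G' (ball z₀ s) := hG'd.continuousOn
  obtain ⟨δ, hδ, hδR⟩ :=
    Metric.continuousAt_iff.1 (hG'c.continuousAt hb) ‖G' z₀‖ (norm_pos_iff.2 hG0)
  set s₁ : ℝ := min s δ with hs₁
  have hs₁pos : 0 < s₁ := lt_min hs hδ
  have hsub : ball z₀ s₁ ⊆ ball z₀ s := ball_subset_ball (min_le_left _ _)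
  have hslit : ∀ w ∈ ball z₀ s₁, G' w / G' z₀ ∈ slitPlane := by
    intro w hw
    have h1 : dist (G' w) (G' z₀) < ‖G' z₀‖ :=
      hδR (lt_of_lt_of_le (mem_ball.1 hw) (min_le_right _ _))
    have h2 : G' w / G' z₀ = 1 + (G' w - G' z₀) / G' z₀ := by field_simp; ring
    rw [h2]
    refine mem_slitPlane_of_norm_lt_one ?_
    rwa [norm_div, div_lt_one (norm_pos_iff.2 hG0), ← dist_eq_norm]
  refine ⟨s₁, fun w => Complex.log (G' w / G' z₀) + Complex.log (G' z₀), hs₁pos, min_le_left _ _,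
    ?_, fun w hw => ?_⟩
  · intro w hw
    have h1 : DifferentiableAt ℂ (fun w => G' w / G' z₀) w :=
      (hG'd.differentiableAt (isOpen_ball.mem_nhds (hsub hw))).div_const _
    exact ((h1.clog (hslit w hw)).add_const _).differentiableWithinAt
  · rw [Complex.exp_add, Complex.exp_log (slitPlane_ne_zero (hslit w hw)), Complex.exp_log hG0,
      div_mul_cancel₀ _ hG0]

/-- **Normalising a holomorphic logarithm to a given continuous one.**  On a preconnected set
`N` on which `M` and `L` are two continuous logarithms of the same function, `M - M q + L q = L`
for any base point `q ∈ N`. [folklore] -/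
theorem localLog_eqOn {N : Set ℂ} (hN : IsPreconnected N) {M L f : ℂ → ℂ}
    (hM : ContinuousOn M N) (hL : ContinuousOn L N)
    (hMexp : ∀ w ∈ N, Complex.exp (M w) = f w) (hLexp : ∀ w ∈ N, Complex.exp (L w) = f w)
    {q : ℂ} (hq : q ∈ N) : EqOn (fun w => M w - M q + L q) L N := by
  intro w hw
  have hexp : ∀ z ∈ N, Complex.exp (L z) = ((1 : ℝ) : ℂ) * Complex.exp (M z) := fun z hz => by
    rw [ofReal_one, one_mul, hMexp z hz, hLexp z hz]
  have key := Identification.sub_eq_sub_of_exp_eq_mul_exp hN (subset_closure hq) hM hL one_pos hexp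
    (hM.continuousWithinAt hq) (hL.continuousWithinAt hq) w hw
  show M w - M q + L q = L w
  linear_combination -key

/-! ### 4. Registered form -/

/-- **Registered helper `transport_flatReflection`** (∀-closed form of `exists_flatReflection`;
sub-goal F2 of stub `transportRigidity` (E), crux stmt-CriticalPhenomena-14004, line
`polygon-parity-squeeze`). [cite: PommerenkeBBCM1992, Thm. 2.6] -/
theorem transport_flatReflection : ∀ (Ω : Set ℂ) (z₀ n : ℂ) (s : ℝ) (F Fb : ℂ → ℂ), IsOpen Ω → ‖n‖ = 1 → Ω ∩ Metric.ball z₀ s = {w : ℂ | 0 < ((w - z₀) * (starRingEnd ℂ) n).re} ∩ Metric.ball z₀ s → DifferentiableOn ℂ F (Ω ∩ Metric.ball z₀ s) → (∀ w ∈ Ω ∩ Metric.ball z₀ s, 0 < (F w).im) → ContinuousOn Fb (closure Ω ∩ Metric.ball z₀ s) → Set.EqOn Fb F (Ω ∩ Metric.ball z₀ s) → (∀ w ∈ frontier Ω ∩ Metric.ball z₀ s, (Fb w).im = 0) → Set.InjOn Fb (closure Ω ∩ Metric.ball z₀ s) → ∃ G : ℂ → ℂ, DifferentiableOn ℂ G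 (Metric.ball z₀ s) ∧ Set.InjOn G (Metric.ball z₀ s) ∧ Set.EqOn G Fb (closure Ω ∩ Metric.ball z₀ s) ∧ (∀ w ∈ Metric.ball z₀ s, 0 < (G w).im → w ∈ Ω) ∧ (∀ w ∈ Metric.ball z₀ s, (G w).im = 0 → w ∈ frontier Ω) ∧ (∀ w ∈ Metric.ball z₀ s, deriv G w ≠ 0) :=
  fun _Ω _z₀ _n _s _F _Fb hΩ hn hflat hF hpos hFbc hFb hreal hinj =>
    exists_flatReflection hΩ hn hflat hF hpos hFbc hFb hreal hinj

end Transport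

end Summit.CriticalPhenomena.SAWScalingLimit.Theorems.PolygonParitySqueeze
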